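import Mathlib
import Literature.Computability.Complexity.ExtMonotoneGates
import Summits.PneNP.PneNP.Theorems.ConvexRankGatesLinAlgGateBlindDefs
import Summits.PneNP.PneNP.Theorems.ConvexRankGatesLinAlgGateBlindPlanting
import Summits.PneNP.PneNP.Theorems.ConvexRankGatesLinAlgGateBlindDenseRegime
import Summits.PneNP.PneNP.Theorems.ConvexRankGatesLinAlgGateBlindDenseRegimeAux
import Summits.PneNP.PneNP.Theorems.ConvexRankGatesLinAlgGateBlindPermSmallDimAux

/-!
# SG for Hall-cover (König) term gates of small dimension (corollary of the planting theorem; crux `LinAlgGateBlind`, stmt-PneNP-10681, route ConvexRankGates)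

Line `konig-atoms-cancellation-split` of the crux chain (`Cruxes/LinAlgGateBlind/Lines/…`) cuts the GRANK
half of the crux at the König joint; its LOAD-BEARING stub `stub_sgHallCover` asks, at `δ = 1/8` and for
every `c`, eventually in `m`, for `SGAt m (IsHallCoverGate (m^c)) (lOf m) (kOf m) (qOf m) (epsOf c m)`:
every HALL-COVER term gate of dimension `≤ m^c` (pattern data `P₀, P_a ⊆ [d'] × [d']`, `d' ≤ m^c`,
threshold `θ`; the gate REJECTS iff a vertex cover `(A, W)` with `#A + #W < θ` covers the OR-pattern
`P₀ ∪ ⋃_{atom a present} P_a`), fed with clique atoms of `≤ lOf m` vertices, is `epsOf c m`-approximated by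
a small-clique DNF, one-sidedly on the referee pair. The line card records the KNOWN RANGE of that stub as
`d ≤ m^{3/4 - γ}` "by the registered planting theorem `sg_of_maxtermCover`"; this file proves it (the exact
analogue, for Hall-cover gates, of `sgAt_perm_of_fewSubgroups` / `sgAt_perm_of_dim_le` for PERM gates,
`…Theorems.ConvexRankGatesLinAlgGateBlindPermSmallDim`):

* `sgAt_hallCover_of_cover_budget` — non-asymptotic form. The rejection region of a Hall-cover term gate
  is covered by the `≤ 4^{d'}` ALL-OFF events `D_{(A,W)} = {every atom owning a cell of Aᶜ × Wᶜ is absent}`,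
  `(A, W)` ranging over the covers of `P₀` with `#A + #W < θ` (each inside the rejection region), so the
  planting theorem `sg_of_maxtermCover` with `N ≤ 4^d`, `η = ε/#𝒱(l)` gives `SGAt` as soon as
  `(ν·C(l,2))^t·C(m-t,k-t) ≤ ε·C(m,k)` and `4^d·(1/2)^{ν+1}·#𝒱(l) < ε`.
* `sgAt_hallCover_of_dim_le` — for every `c`, eventually in `m`, for EVERY `d` with `4d ≤ m^{3/4}`:
  `SGAt m (HALLCOVER_d) (lOf m) (kOf m) (qOf m) (epsOf c m)` (budgets `permSmallDim_budgets` at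
  `ν = ⌈m^{3/4}⌉₊`, `t = ⌊lOf m/2⌋`; dense-regime facts `stub_denseRegime`).

So the open window of `stub_sgHallCover` is exactly `m^{3/4}/4 < d ≤ m^c`. The class `IsHallCoverGate d`
of the line is written INLINE here (its definition unfolded: `orPattern`, `IsCover`), so the statements are
definitionally those of the line. Sources: Alon–Boppana 1987 §3, Razborov 1985 (approximation method); the
planting theorem is the tree's. [folklore]
-/

noncomputable section

namespace Summit.PneNP.PneNP.Theorems

open scoped BigOperators
open Finset Filter Literature.Computability.Complexity Razborov
open Summit.PneNP.PneNP.Cruxes.LinAlgGateBlind.DnfInvariantWideGatesSeeSmallCliques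

/-- **SG for Hall-cover term gates under the two planting budgets (corollary of `sg_of_maxtermCover`).**
Let `0 ≤ q ≤ 1`, `1 - q^{C(l,2)} ≤ 1/2`, `0 < ε`, `2t ≤ l`, and suppose the POSITIVE budget
`(ν·C(l,2))^t · C(m-t, k-t) ≤ ε·C(m,k)` and the FRAGILITY budget `4^d · (1/2)^{ν+1} · #𝒱(l) < ε`. Then
`SGAt m (HALLCOVER_d) l k q ε` (`HALLCOVER_d` = the line's `IsHallCoverGate d`, unfolded): a Hall-cover term
gate `O` over `≤ l`-atoms rejects `x` iff some cover `(A, W)` of the constant pattern `P₀` with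
`#A + #W < θ` has every atom owning a cell of the rectangle `Aᶜ × Wᶜ` absent in `x`; these `≤ 4^{d'} ≤ 4^d`
all-off events cover the rejection region from inside, so the planting theorem with `η = ε/#𝒱(l)` yields
a small-clique DNF with `#lostPos ≤ ε·C(m,k)` and `gainedNeg ≤ #𝒱(l)·η = ε`. [folklore] -/
theorem sgAt_hallCover_of_cover_budget : ∀ (m l k d ν t : ℕ) (q ε : ℝ), 0 ≤ q → q ≤ 1 →
    1 - q ^ (l.choose 2) ≤ 1 / 2 → 0 < ε → 2 * t ≤ l →
    (((ν * l.choose 2) ^ t * (m - t).choose (k - t) : ℕ) : ℝ) ≤ ε * (m.choose k : ℝ) →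
    (4 : ℝ) ^ d * (1 / 2) ^ (ν + 1) * #(smallSets (Fin m) l) < ε →
    SGAt m (fun g => ∃ d' θ : ℕ, d' ≤ d ∧ ∃ (P₀ : Set (Fin d' × Fin d'))
      (P : Fin g.1 → Set (Fin d' × Fin d')), ∀ v : Fin g.1 → Bool, g.2 v = false ↔
        ∃ A W : Finset (Fin d'), #A + #W < θ ∧
          ∀ x ∈ {x | x ∈ P₀ ∨ ∃ i, v i = true ∧ x ∈ P i}, x.1 ∈ A ∨ x.2 ∈ W) l k q ε := by
  intro m l k d ν t q ε hq0 hq1 hql hε htl hpos hfrag O hO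
  classical
  obtain ⟨g, ⟨d', θ, hd', P₀, P, hg⟩, X, hX, hOX⟩ := hO
  -- the maxterm cover of a Hall-cover term gate: `O x = 0` iff some cover `(A, W)` of `P₀` with `#A + #W < θ`
  -- has every atom owning an uncovered cell absent
  have hiff : ∀ x, O x = false ↔ ∃ A W : Finset (Fin d'), #A + #W < θ ∧
      (∀ y ∈ P₀, y.1 ∈ A ∨ y.2 ∈ W) ∧
        ∀ a, (∃ y ∈ P a, y.1 ∉ A ∧ y.2 ∉ W) → ¬ CliquePresent (X a) x := by
    intro x
    rw [hOX x, hg]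
    refine exists_congr fun A => exists_congr fun W => and_congr_right fun _ => ?_
    constructor
    · intro hcov
      refine ⟨fun y hy => hcov y (Or.inl hy), fun a ⟨y, hy, hyA, hyW⟩ hP => ?_⟩
      rcases hcov y (Or.inr ⟨a, by simpa [atomB] using hP, hy⟩) with h | h
      · exact hyA h
      · exact hyW h
    · rintro ⟨h0, h1⟩ y (hy | ⟨a, ha, hy⟩)
      · exact h0 y hy
      · by_contra hnot
        simp only [not_or] at hnot
        exact h1 a ⟨y, hy, hnot.1, hnot.2⟩ (by simpa [atomB] using ha)
  -- index the maxterm cover by the small covers of `P₀`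
  have hV : (0 : ℝ) < #(smallSets (Fin m) l) := Nat.cast_pos.2 (card_pos.2 ⟨∅, empty_mem_smallSets l⟩)
  set J := {p : Finset (Fin d') × Finset (Fin d') // #p.1 + #p.2 < θ ∧ ∀ y ∈ P₀, y.1 ∈ p.1 ∨ y.2 ∈ p.2}
    with hJ
  set N := Nat.card J with hNdef
  set e : J ≃ Fin N := Finite.equivFin J with he
  set 𝓛 : Fin N → Finset (Finset (Fin m)) := fun j =>
    (univ.filter fun a => ∃ y ∈ P a, y.1 ∉ (e.symm j).1.1 ∧ y.2 ∉ (e.symm j).1.2).image X with h𝓛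
  have hNle : (N : ℝ) ≤ (4 : ℝ) ^ d := by
    have h1 : N ≤ Nat.card (Finset (Fin d') × Finset (Fin d')) :=
      Nat.card_le_card_of_injective (Subtype.val : J → Finset (Fin d') × Finset (Fin d'))
        Subtype.val_injective
    have h2 : Nat.card (Finset (Fin d') × Finset (Fin d')) = 4 ^ d' := by
      rw [Nat.card_prod, Nat.card_eq_fintype_card, Fintype.card_finset, Fintype.card_fin,
        ← mul_pow]
      norm_num
    have h3 : (4 : ℕ) ^ d' ≤ 4 ^ d := Nat.pow_le_pow_right (by norm_num) hd'
    exact_mod_cast (h1.trans_eq h2).trans h3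
  have hN : (N : ℝ) * (1 / 2) ^ (ν + 1) < ε / #(smallSets (Fin m) l) := by
    rw [lt_div_iff₀ hV]
    calc (N : ℝ) * (1 / 2) ^ (ν + 1) * #(smallSets (Fin m) l)
        ≤ (4 : ℝ) ^ d * (1 / 2) ^ (ν + 1) * #(smallSets (Fin m) l) := by gcongr
      _ < ε := hfrag
  have h1 : ∀ j, 𝓛 j ⊆ smallSets (Fin m) l := by
    intro j Y hY
    obtain ⟨a, -, rfl⟩ := mem_image.1 hY
    exact hX a
  have h2 : ∀ x, O x = false → ∃ j, ∀ Y ∈ 𝓛 j, ¬ CliquePresent Y x := by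
    intro x hx
    obtain ⟨A, W, hAW, h0, hoff⟩ := (hiff x).1 hx
    refine ⟨e ⟨(A, W), hAW, h0⟩, fun Y hY => ?_⟩
    obtain ⟨a, ha, rfl⟩ := mem_image.1 hY
    rw [mem_filter, Equiv.symm_apply_apply] at ha
    exact hoff a ha.2
  have h3 : ∀ j x, (∀ Y ∈ 𝓛 j, ¬ CliquePresent Y x) → O x = false := fun j x hall =>
    (hiff x).2 ⟨(e.symm j).1.1, (e.symm j).1.2, (e.symm j).2.1, (e.symm j).2.2, fun a ha =>
      hall (X a) (mem_image_of_mem X (mem_filter.2 ⟨mem_univ a, ha⟩))⟩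
  obtain ⟨𝒜, h𝒜, hP, hNg⟩ := sg_of_maxtermCover m l k N ν t q (ε / #(smallSets (Fin m) l)) O 𝓛 h1 h2 h3
    hq0 hq1 hql (div_pos hε hV) hN htl
  refine ⟨𝒜, h𝒜, ?_, hNg.trans_eq (mul_div_cancel₀ ε hV.ne')⟩
  calc (#(lostPos m k O 𝒜) : ℝ) ≤ (((ν * l.choose 2) ^ t * (m - t).choose (k - t) : ℕ) : ℝ) := by
        exact_mod_cast hP
    _ ≤ ε * (m.choose k : ℝ) := hpos

open DenseRegime in
/-- **SG for Hall-cover (König) term gates of dimension `≤ m^{3/4}/4`, at the parameters of the line** — the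
KNOWN RANGE of the load-bearing stub `stub_sgHallCover` of line `konig-atoms-cancellation-split`. For every
`c`, eventually in `m`: for every `d` with `4d ≤ m^{3/4}`, `SGAt m (HALLCOVER_d) (lOf m) (kOf m) (qOf m) (epsOf c m)`
(`HALLCOVER_d` = the line's `IsHallCoverGate d`, unfolded) — every Hall-cover term gate of dimension `≤ d` over
`≤ lOf m`-atoms is `epsOf c m`-approximated, one-sidedly on (bare `kOf m`-cliques, `G(m, qOf m)`), by a
small-clique DNF. Proof: `sgAt_hallCover_of_cover_budget` with `ν = ⌈m^{3/4}⌉₊`, `t = ⌊lOf m/2⌋`, the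
dense-regime facts (`stub_denseRegime`) and the budgets `permSmallDim_budgets` (`4^d = 2^{2d} ≤ 2^{m^{3/4}/2}`).
The stub itself couples `d = m^c`; its open window is therefore `m^{3/4}/4 < d ≤ m^c`. [folklore] -/
theorem sgAt_hallCover_of_dim_le : ∀ c : ℕ, ∀ᶠ m : ℕ in atTop, ∀ d : ℕ, 4 * (d : ℝ) ≤ (m : ℝ) ^ (3 / 4 : ℝ) →
    SGAt m (fun g => ∃ d' θ : ℕ, d' ≤ d ∧ ∃ (P₀ : Set (Fin d' × Fin d'))
      (P : Fin g.1 → Set (Fin d' × Fin d')), ∀ v : Fin g.1 → Bool, g.2 v = false ↔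
        ∃ A W : Finset (Fin d'), #A + #W < θ ∧
          ∀ x ∈ {x | x ∈ P₀ ∨ ∃ i, v i = true ∧ x ∈ P i}, x.1 ∈ A ∨ x.2 ∈ W)
      (lOf m) (kOf m) (qOf m) (epsOf c m) := by
  intro c
  filter_upwards [stub_denseRegime c, permSmallDim_budgets c, eventually_ge_atTop 1] with m hD hB hm d hd
  obtain ⟨-, -, -, hq0, hq1, -, -, -, -, hhalf⟩ := hD
  obtain ⟨hpos, hfrag⟩ := hB
  have hε : 0 < epsOf c m := by
    rw [epsOf_eq]
    positivity
  have hN : (4 : ℝ) ^ d ≤ (2 : ℝ) ^ ((m : ℝ) ^ (3 / 4 : ℝ) / 2) := by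
    have h4 : (4 : ℝ) ^ d = (2 : ℝ) ^ (2 * (d : ℝ)) := by
      rw [Real.rpow_mul (by norm_num : (0 : ℝ) ≤ 2), Real.rpow_two, Real.rpow_natCast]
      norm_num
    rw [h4]
    exact Real.rpow_le_rpow_of_exponent_le one_le_two (by linarith)
  refine sgAt_hallCover_of_cover_budget m (lOf m) (kOf m) d ⌈(m : ℝ) ^ (3 / 4 : ℝ)⌉₊ (lOf m / 2)
    (qOf m) (epsOf c m) hq0 hq1 (by linarith) hε (Nat.mul_div_le (lOf m) 2) hpos ?_
  calc (4 : ℝ) ^ d * (1 / 2) ^ (⌈(m : ℝ) ^ (3 / 4 : ℝ)⌉₊ + 1) * #(smallSets (Fin m) (lOf m))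
      ≤ (2 : ℝ) ^ ((m : ℝ) ^ (3 / 4 : ℝ) / 2) * (1 / 2) ^ (⌈(m : ℝ) ^ (3 / 4 : ℝ)⌉₊ + 1) *
        #(smallSets (Fin m) (lOf m)) := by gcongr
    _ < epsOf c m := hfrag

end Summit.PneNP.PneNP.Theorems

end
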